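import Summits.QuantumFields.YangMills.Theorems.BalabanUVNodesPortS1RecordDtJacBlockDet

/-!
# Port S1, socket (o3)-X — THE δ-FUNCTION JACOBIAN SPLITS: `det ∂_{b₀}Q̃_ℂ(B′) = det A₁ · det DΨ(B′)` at `B′ = Φ(B)`, i.e. `|det ∂_{b₀}Q̃|⁻¹ = |det A₁|⁻¹ · |det(1 − h δD̃∕δB)|`
# ([I] p.267–268: the coefficient of `B′(b₀(c))` in `Q̃(B′)` gives `Z^{(k)}`'s `|det A₁|⁻¹` (✓`recordZkLoc`) AND the `D̃`-Jacobian of (2.12) — one determinant, two factors)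

Cell `ym-nodeO-ideate`, porter seat PT-A-1 (gen 10); `--kind proof --supports stmt-QuantumFields-27930 --as helper`; count-neutral.  [I] = [Balaban1987RG1]; [15] = [Balaban1985Variational].
Over ✓`…PortS1RecordDtJacBlock` (p829303: `DQ̃_ℂ(Φ B) = LQ̃_ℂ ∘L DΨ(Φ B)`), ✓`…PortS1RecordDtJacBlockDet` (p829349: `det(1 + h_ℂ∘A)` = determinant of its `b₀`-block), ✓`…PortS1QtCHop`
(`coarseCoordC_recordLQtC`: the 𝔰𝔩(2)-coordinates of `LQ̃_ℂ v` are `(recordLQtMat.map ↑) *ᵥ v`).  The (L3-d) row of `FIBRE-CHART-LAW-v1.md` («`jd_c` in the chart = (o3) `Tr log(1 − hδD̃∕δB)` + constants»):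
in coordinates the fibre density of print's δ-function `Π_c δ(Q̃(B′)(c))` is `|det ∂_{x_{b₀}}Q̃|⁻¹` at the solved point; this file proves that determinant FACTORS as print uses it.

WHAT IS PROVED (letters (o1-ε) at a quantified radius `ρ`, `RecordB0BlockInvertible`; `R = 1∕(10⁸dL)`, `C₂ = 2∕R²`):
* `one_add_hop_comp_single_b0_apply_of_not_mem` (`(DΨ e_{(b₀c′,j′)})_i = 0` off the `b₀`-rows); ★★ `su2CoordCt_fderiv_recordQtC_recordPhi_single_b0` — THE `b₀`-JACOBIAN OF THE CONSTRAINT AT `B′ = Φ(B)` IS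
  `A₁^ℂ · (DΨ(B′))_{b₀b₀}` entrywise: `su2CoordCt (DQ̃_ℂ(ΦB) e_{(b₀c′,j′)} (c)) j = Σ_{(c″,j″)} A₁(cj, c″j″) · (DΨ(ΦB) e_{(b₀c′,j′)})_{(b₀c″,j″)}`;
* ★★★ `det_b0Jacobian_recordQtC_recordPhi` — `det [su2CoordCt (DQ̃_ℂ(Φ B) e_{(b₀c′,j′)} c) j] = det A₁^ℂ · det DΨ(Φ B)`; with ✓`det_one_sub_hop_comp_fderiv_recordDt_eq_inv`:
  ★★★ `det_b0Jacobian_recordQtC_recordPhi_mul_det_recordPhi` — `det [∂_{b₀}Q̃_ℂ(ΦB)] · det(1 − h_ℂ∘DD̃(B)) = det A₁^ℂ` («one determinant, two factors»).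

HONEST FRAMING.  Linear algebra over landed bricks; the measure-theoretic chart law itself ((T1): the fibre integral of ✓`TcanOfRecord` in these coordinates) and (T2) are NOT here; nothing of Bałaban's
renormalization-group estimates asserted, ported or discharged; `stub_FE(step)` (XXL) ∕ `stub_P0C` OPEN, ⟨27930⟩ OPEN (1∕3); NODE O 0∕1; COUNT 8∕28 · K 1∕4 UNMOVED; finite `𝕋⁴_{L^K}` at fixed ε —
NOT continuum ∕ OS; **the Yang–Mills mass gap (Clay) is NOT proved by any of this.**  No `sorry`, no `def`, no `instance`; standard axioms only.
-/

noncomputable section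

open scoped BigOperators Matrix.Norms.L2Operator Topology

open Set Metric Filter

namespace Summit.QuantumFields.YangMills.Theorems.BalabanUVNodesPortS1

open Summit.QuantumFields.YangMills.Theorems.K0RecordFormatNames
open Literature.MathematicalPhysics.QuantumFieldTheory.Balaban1983to89
open Literature.MathematicalPhysics.QuantumFieldTheory.Balaban1983to89.Node00
open Literature.MathematicalPhysics.QuantumFieldTheory.Balaban1983to89.T4Continuum (T4Family)
open Literature.MathematicalPhysics.QuantumFieldTheory.Balaban1983to89.BlockAveraging (Small Idx)
open Literature.MathematicalPhysics.QuantumFieldTheory.Balaban1983to89.ExpMeanLog (expMeanLogSU)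
open _root_.Matrix

variable (F : T4Family)

/-- `(1 + h_ℂ∘A) e_{(b₀c′,j′)}` vanishes at every non-`b₀` coordinate. [cite: Balaban1987RG1, p.267] -/
theorem one_add_hop_comp_single_b0_apply_of_not_mem (k K : ℕ) (Vk : GaugeField (F.P K) k (SU 2)) (A : (FluctIdx F k K → ℂ) →L[ℂ] (PBond (F.P K) (k + 1) → MatA 2))
    (c'j' : CoarseIdx F k K) (i : FluctIdx F k K) (hi : i.1 ∉ Set.range (recordB0 F k K)) :
    (((1 : (FluctIdx F k K → ℂ) →L[ℂ] (FluctIdx F k K → ℂ)) + (LinearMap.toContinuousLinearMap (hopLinGraphC F k K Vk)).comp A)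
        (Pi.single ((recordB0 F k K c'j'.1, c'j'.2) : FluctIdx F k K) 1)) i = 0 := by
  rw [one_add_hop_comp_apply_of_not_mem F k K Vk A _ i hi]
  exact single_b0_apply_of_not_mem F k K c'j' i hi

section Letters

variable {F}
variable {k K : ℕ} (hk : k + 1 ≤ (F.P K).m + (F.P K).K) (Vk : GaugeField (F.P K) k (SU 2)) {ε : ℝ}
  (hε : ∀ (c : PBond (F.P K) (k + 1)) (i : Idx (F.P K)), ‖loopM (coeField Vk) c i - 1‖ ≤ ε) (hε50 : ε ≤ 1 / 50)
  (hVk : ∀ c, Small expMeanLogSU Vk c) {b ρ : ℝ} (hb : 0 ≤ b) (hHop : ∀ X, ‖hopLinGraphC F k K Vk X‖ ≤ b * ‖X‖)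
  (hq : 9 * (2 * 1 / (1 / (10 ^ 8 * (F.P K).d * (F.P K).L)) ^ 2) * b * ρ < 1) (hρ : 3 * ρ ≤ 1 / (10 ^ 8 * (F.P K).d * (F.P K).L))

include hk hε hε50 hVk in
/-- For ANY operator `A`: the 𝔰𝔩(2)-coordinates of `LQ̃_ℂ((1 + h_ℂ∘A) e_{(b₀c′,j′)})` only read the `b₀`-block of `1 + h_ℂ∘A`:
`coarseCoordC (LQ̃_ℂ ((1 + h_ℂ∘A) e_{(b₀c′,j′)})) (c,j) = Σ_{(c″,j″)} A₁^ℂ((c,j),(c″,j″)) · ((1 + h_ℂ∘A) e_{(b₀c′,j′)})_{(b₀c″,j″)}`. [cite: Balaban1987RG1, p.267–268] -/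
theorem coarseCoordC_recordLQtC_one_add_hop_comp_single_b0 (A : (FluctIdx F k K → ℂ) →L[ℂ] (PBond (F.P K) (k + 1) → MatA 2)) (cj c'j' : CoarseIdx F k K) :
    coarseCoordC F k K (recordLQtC F k K Vk
        ((((1 : (FluctIdx F k K → ℂ) →L[ℂ] (FluctIdx F k K → ℂ)) + (LinearMap.toContinuousLinearMap (hopLinGraphC F k K Vk)).comp A)
          (Pi.single ((recordB0 F k K c'j'.1, c'j'.2) : FluctIdx F k K) 1)))) cj =
      ∑ c''j'' : CoarseIdx F k K, recordLQtB0C F k K Vk cj c''j'' *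
        (((1 : (FluctIdx F k K → ℂ) →L[ℂ] (FluctIdx F k K → ℂ)) + (LinearMap.toContinuousLinearMap (hopLinGraphC F k K Vk)).comp A)
          (Pi.single ((recordB0 F k K c'j'.1, c'j'.2) : FluctIdx F k K) 1)) (recordB0 F k K c''j''.1, c''j''.2) := by
  classical
  set w := (((1 : (FluctIdx F k K → ℂ) →L[ℂ] (FluctIdx F k K → ℂ)) + (LinearMap.toContinuousLinearMap (hopLinGraphC F k K Vk)).comp A)
          (Pi.single ((recordB0 F k K c'j'.1, c'j'.2) : FluctIdx F k K) 1)) with hw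
  rw [coarseCoordC_recordLQtC F k K hk Vk hε hε50 hVk w, Matrix.mulVec, dotProduct]
  -- split the sum over `FluctIdx` along the bijection `blkToFluct : CoarseIdx ⊕ NonB0Idx → FluctIdx`
  rw [← (blkToFluct_bijective F k K hk).sum_comp (fun i => (recordLQtMat F k K Vk).map (algebraMap ℝ ℂ) cj i * w i), Fintype.sum_sum_type]
  have hzero : ∑ i : NonB0Idx F k K, (recordLQtMat F k K Vk).map (algebraMap ℝ ℂ) cj (blkToFluct F k K (Sum.inr i)) * w (blkToFluct F k K (Sum.inr i)) = 0 := by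
    refine Finset.sum_eq_zero fun i _ => ?_
    have : w (blkToFluct F k K (Sum.inr i)) = 0 := one_add_hop_comp_single_b0_apply_of_not_mem F k K Vk A c'j' i.1 i.2
    rw [this, mul_zero]
  rw [hzero, add_zero]
  refine Finset.sum_congr rfl fun c''j'' _ => ?_
  rfl

include hk hε hε50 hVk hb hHop hq hρ in
/-- ★★ **THE `b₀`-JACOBIAN OF THE CONSTRAINT AT `B′ = Φ(B)` IS `A₁^ℂ · (DΨ(B′))_{b₀b₀}`** (entrywise), `‖B‖ < ρ`, under `RecordB0BlockInvertible` (✓`fderiv_recordQtC_recordPhi_eq` + the previous lemma).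
[cite: Balaban1987RG1, p.267 («a coefficient at the variable B′(b₀(c)) in (Q̃B′)(c)»)] -/
theorem su2CoordCt_fderiv_recordQtC_recordPhi_single_b0 (hA : RecordB0BlockInvertible F k K Vk) {B : FluctIdx F k K → ℂ} (hB : ‖B‖ < ρ) (cj c'j' : CoarseIdx F k K) :
    su2CoordCt (fderiv ℂ (recordQtC F k K Vk) (B - hopLinGraphC F k K Vk (recordDt F k K Vk ρ B))
        (Pi.single ((recordB0 F k K c'j'.1, c'j'.2) : FluctIdx F k K) 1) cj.1) cj.2 =
      ∑ c''j'' : CoarseIdx F k K, recordLQtB0C F k K Vk cj c''j'' *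
        (((1 : (FluctIdx F k K → ℂ) →L[ℂ] (FluctIdx F k K → ℂ)) +
            (LinearMap.toContinuousLinearMap (hopLinGraphC F k K Vk)).comp
              (fderiv ℂ (recordCtC F k K Vk) (B - hopLinGraphC F k K Vk (recordDt F k K Vk ρ B))))
          (Pi.single ((recordB0 F k K c'j'.1, c'j'.2) : FluctIdx F k K) 1)) (recordB0 F k K c''j''.1, c''j''.2) := by
  rw [fderiv_recordQtC_recordPhi_eq hk Vk hε hε50 hVk hb hHop hq hρ hA hB]
  exact coarseCoordC_recordLQtC_one_add_hop_comp_single_b0 hk Vk hε hε50 hVk _ cj c'j'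

include hk hε hε50 hVk hb hHop hq hρ in
/-- ★★★ **`det ∂_{b₀}Q̃_ℂ(Φ B) = det A₁^ℂ · det DΨ(Φ B)`**: the `b₀`-Jacobian determinant of the constraint at the translated point is the product of `Z^{(k)}`'s `det A₁` and the determinant of
`DΨ(Φ B) = 1 + h_ℂ∘DC̃_ℂ(Φ B)` (block form ✓`det_one_add_hop_comp_eq_det_b0Block`). [cite: Balaban1987RG1, p.267–268, (2.12) p.268, (1.4) p.260] -/
theorem det_b0Jacobian_recordQtC_recordPhi (hA : RecordB0BlockInvertible F k K Vk) {B : FluctIdx F k K → ℂ} (hB : ‖B‖ < ρ) :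
    Matrix.det (fun cj c'j' : CoarseIdx F k K =>
        su2CoordCt (fderiv ℂ (recordQtC F k K Vk) (B - hopLinGraphC F k K Vk (recordDt F k K Vk ρ B))
          (Pi.single ((recordB0 F k K c'j'.1, c'j'.2) : FluctIdx F k K) 1) cj.1) cj.2) =
      (recordLQtB0C F k K Vk).det *
        LinearMap.det (((1 : (FluctIdx F k K → ℂ) →L[ℂ] (FluctIdx F k K → ℂ)) +
          (LinearMap.toContinuousLinearMap (hopLinGraphC F k K Vk)).comp
            (fderiv ℂ (recordCtC F k K Vk) (B - hopLinGraphC F k K Vk (recordDt F k K Vk ρ B)))).toLinearMap) := by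
  rw [det_one_add_hop_comp_eq_det_b0Block hk Vk, ← Matrix.det_mul]
  congr 1
  ext cj c'j'
  rw [Matrix.mul_apply]
  exact su2CoordCt_fderiv_recordQtC_recordPhi_single_b0 hk Vk hε hε50 hVk hb hHop hq hρ hA hB cj c'j'

include hk hε hε50 hVk hb hHop hq hρ in
/-- ★★★ **«ONE DETERMINANT, TWO FACTORS»**: `det ∂_{b₀}Q̃_ℂ(Φ B) · det(1 − h_ℂ∘DD̃(B)) = det A₁^ℂ` — the δ-function Jacobian `|det ∂_{b₀}Q̃|⁻¹` at the solved point is `|det A₁|⁻¹ · |det(1 − h δD̃∕δB)|`: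
the first factor is `Z^{(k)}`'s (✓`recordZkLoc := |det A₁|⁻¹ · Z14 …`), the second is (2.12)'s `D̃`-Jacobian (✓`recordDtJacOf`). [cite: Balaban1987RG1, (1.4) p.260, (2.12) p.268, p.267] -/
theorem det_b0Jacobian_recordQtC_recordPhi_mul_det_recordPhi (hA : RecordB0BlockInvertible F k K Vk) {B : FluctIdx F k K → ℂ} (hB : ‖B‖ < ρ) :
    Matrix.det (fun cj c'j' : CoarseIdx F k K =>
        su2CoordCt (fderiv ℂ (recordQtC F k K Vk) (B - hopLinGraphC F k K Vk (recordDt F k K Vk ρ B))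
          (Pi.single ((recordB0 F k K c'j'.1, c'j'.2) : FluctIdx F k K) 1) cj.1) cj.2) *
      LinearMap.det (((1 : (FluctIdx F k K → ℂ) →L[ℂ] (FluctIdx F k K → ℂ)) -
        (LinearMap.toContinuousLinearMap (hopLinGraphC F k K Vk)).comp (fderiv ℂ (recordDt F k K Vk ρ) B)).toLinearMap) =
      (recordLQtB0C F k K Vk).det := by
  rw [det_b0Jacobian_recordQtC_recordPhi hk Vk hε hε50 hVk hb hHop hq hρ hA hB, mul_assoc,
    mul_comm (LinearMap.det _) (LinearMap.det _),
    det_one_sub_hop_comp_fderiv_recordDt_mul hk Vk hε hε50 hVk hb hHop hq hρ hB, mul_one]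

end Letters

end Summit.QuantumFields.YangMills.Theorems.BalabanUVNodesPortS1

end
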